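import Mathlib
import HarnessLib
import Summits.Parity.GeneralizedHardyLittlewood.Theses.LeeYangFibres
import Summits.Parity.GeneralizedHardyLittlewood.Theorems.LeeYangFibresModelHyperbolicity
import Summits.Parity.GeneralizedHardyLittlewood.Theorems.LeeYangFibresFibreHyperbolicityLawOneNormGT
import Literature.NumberTheory.Sieve.LinearEquationsInPrimesCrudeBounds

/-!
# Crux `FibreHyperbolicity` (stmt-Parity-14108), line `SketchIdeator1` (model transfer):
# stub `stub_lawOneNorm` — `SegmentLawOne → CellModelLaw 1`

The `t = 1` cell law of the line, from the segment law for one progression (the stub's hypothesis,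
proved separately as `stub_lawOneAnalytic`), by the Green–Tao normalisations at `t = d = 1`.
For `Ψ = (ψ)`, `ψ(n) = a n + b` (`a ≠ 0` by non-degeneracy) and a convex `K ⊆ [-N, N]`:

* reflect by `s = sign a` (`n ↦ s n`, `a' = s a = |a| ≥ 1`): the joint rough `Ω`-cell of the crux
  is the count of integers `m ∈ [-N, N]` of the window
  `J = {y : (s y) ∈ K, a' y + b > 0}` whose value `a' m + b` is `N^{1/u}`-rough with `Ω = j₀`
  (`lawOne_count`; roughness forces `a' m + b ≥ 2 > 0` once `N ≥ 2^u`);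
* `β_∞ = archFactor Ψ K = vol(J)` (`lawOne_archFactor`: `K ∩ {ψ > 0}` is the box over a window whose
  reflection is `J`), `J` is order-connected (convexity) and `⊆ [-N, N]`;
* `𝔖 = ∏_p β_p` satisfies `0 ≤ 𝔖 ≤ B(L)` and `𝔖 > 0 ⇒ gcd(a, b) = 1` (helper file `…LawOneNormGT`),
  so `η N ≤ β_∞ 𝔖` gives `vol(J) ≥ η N / B ≥ η' N + 1`, `η' = η/(2B)`, for `N ≥ 2B/η`;
* the integer points of `J` are consecutive and `n ↦ a' n + b` maps them onto the class `b mod a'`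
  of a segment `(M₁, M₂] ⊆ (0, L N]` of length `≥ η' N` (`lawOne_oneDim`, `lawOne_core`), where the
  segment law (with `η'` in place of `η`) is exactly the required cell law,
  `Λ = (M₂ - M₁)/(φ(a') log N)`.
-/

noncomputable section

namespace Summit.Parity.GeneralizedHardyLittlewood.Cruxes.FibreHyperbolicity.ModelTransfer

open scoped BigOperators Classical
open Finset Polynomial Filter MeasureTheory
open scoped Topology
open Literature.NumberTheory.Sieve
open Summit.Parity.GeneralizedHardyLittlewood.Cruxes.ModelHyperbolicity.WindowChainTransport (cellDensity)

/-! ### Roughness forces positivity -/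

/-- `N^{1/u} ≥ 2` once `N ≥ 2^u`. -/
theorem lawOne_two_le_rpow {u N : ℕ} (hu : 2 ≤ u) (hN : 2 ^ u ≤ N) :
    (2 : ℝ) ≤ (N : ℝ) ^ ((1 : ℝ) / u) := by
  have hu0 : (0 : ℝ) < u := by positivity
  rw [one_div, Real.le_rpow_inv_iff_of_pos (by norm_num) (by positivity) hu0, Real.rpow_natCast]
  exact_mod_cast hN

/-- An integer whose least prime factor exceeds `X ≥ 2` is `≥ 2` (`minFac 0 = 2`, `minFac 1 = 1`). -/
theorem lawOne_two_le_of_lt_minFac {X : ℝ} (hX : 2 ≤ X) {m : ℕ} (h : X < (Nat.minFac m : ℝ)) :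
    2 ≤ m := by
  by_contra hm
  have : m = 0 ∨ m = 1 := by omega
  rcases this with rfl | rfl
  · rw [Nat.minFac_zero] at h
    norm_num at h
    linarith
  · rw [Nat.minFac_one] at h
    norm_num at h
    linarith

/-! ### The window of one form: order-connectedness, boundedness, volume `= β_∞` -/

/-- The (reflected) window `J = {y : (s y) ∈ K, a' y + b > 0}` (`a' = s a`) is the preimage of the
convex set `K ∩ {ψ > 0}` under the linear map `y ↦ (s y) ∈ ℝ¹`, hence order-connected. -/
theorem lawOne_window_ordConnected (Ψ : Fin 1 → AffLinForm 1) {K : Set (Fin 1 → ℝ)}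
    (hK : Convex ℝ K) {s a b a' : ℤ} (ha : (Ψ 0).coeff 0 = a) (hb : (Ψ 0).const = b)
    (ha' : a' = s * a) {J : Set ℝ}
    (hJ : ∀ y, y ∈ J ↔ (fun _ : Fin 1 => (s : ℝ) * y) ∈ K ∧ 0 < (a' : ℝ) * y + b) :
    J.OrdConnected := by
  have hlin : IsLinearMap ℝ (fun y : ℝ => (fun _ : Fin 1 => (s : ℝ) * y)) := by
    refine ⟨fun x y => ?_, fun c x => ?_⟩
    · funext i
      simp only [Pi.add_apply]
      ring
    · funext i
      simp only [Pi.smul_apply, smul_eq_mul]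
      ring
  have hJeq : J = (fun y : ℝ => (fun _ : Fin 1 => (s : ℝ) * y)) ⁻¹' posBody Ψ 0 K := by
    ext y
    simp only [hJ, Set.mem_preimage, posBody, Set.mem_inter_iff, Set.mem_setOf_eq,
      Fin.forall_fin_one, lawOne_realEval, ha, hb, ha', Int.cast_mul]
    rw [show ((s : ℝ) * a) * y = (a : ℝ) * ((s : ℝ) * y) by ring]
  rw [hJeq]
  exact ((convex_posBody Ψ 0 hK).is_linear_preimage hlin).ordConnected

/-- The window lies in `[-N, N]` when `K ⊆ [-N, N]` (`s = ±1`). -/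
theorem lawOne_window_subset {K : Set (Fin 1 → ℝ)} {N : ℕ} (hKN : K ⊆ realBox 1 N)
    {s a' b : ℤ} (hs : s = 1 ∨ s = -1) {J : Set ℝ}
    (hJ : ∀ y, y ∈ J ↔ (fun _ : Fin 1 => (s : ℝ) * y) ∈ K ∧ 0 < (a' : ℝ) * y + b) :
    J ⊆ Set.Icc (-(N : ℝ)) N := by
  intro y hy
  have hmem := hKN ((hJ y).mp hy).1
  rw [realBox, Set.mem_Icc] at hmem
  have h1 : -(N : ℝ) ≤ (s : ℝ) * y := (Pi.le_def.mp hmem.1) 0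
  have h2 : (s : ℝ) * y ≤ N := (Pi.le_def.mp hmem.2) 0
  rcases hs with rfl | rfl
  · push_cast at h1 h2
    exact ⟨by linarith, by linarith⟩
  · push_cast at h1 h2
    exact ⟨by linarith, by linarith⟩

/-- **`β_∞ = vol(J)`**: `archFactor Ψ K = vol₁(K ∩ {ψ > 0}) = vol({y : (y) ∈ K, a y + b > 0})`
(`K ∩ {ψ > 0}` is the one-dimensional box over that window), and the reflection `y ↦ s y`
(`s = ±1`) preserves Lebesgue measure. -/
theorem lawOne_archFactor (Ψ : Fin 1 → AffLinForm 1) (K : Set (Fin 1 → ℝ)) {s a b a' : ℤ}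
    (hs : s = 1 ∨ s = -1) (ha : (Ψ 0).coeff 0 = a) (hb : (Ψ 0).const = b) (ha' : a' = s * a)
    {J : Set ℝ} (hJ : ∀ y, y ∈ J ↔ (fun _ : Fin 1 => (s : ℝ) * y) ∈ K ∧ 0 < (a' : ℝ) * y + b) :
    archFactor Ψ K = (volume J).toReal := by
  -- the window before reflection; `K ∩ {ψ > 0}` is the box over it in `ℝ¹`
  set J₀ : Set ℝ := {y | (fun _ : Fin 1 => y) ∈ K ∧ 0 < (a : ℝ) * y + b} with hJ₀
  have h1 : K ∩ {x | ∀ i, 0 < (Ψ i).realEval x} = Set.pi Set.univ (fun _ : Fin 1 => J₀) := by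
    ext x
    have hx : (fun _ : Fin 1 => x 0) = x := funext fun i => by rw [Fin.fin_one_eq_zero i]
    rw [Set.mem_inter_iff, Set.mem_setOf_eq, Fin.forall_fin_one, lawOne_realEval, ha, hb,
      Set.mem_univ_pi, Fin.forall_fin_one]
    show _ ↔ (fun _ : Fin 1 => x 0) ∈ K ∧ 0 < (a : ℝ) * x 0 + b
    rw [hx]
  have hs0 : (s : ℝ) ≠ 0 := by rcases hs with rfl | rfl <;> norm_num
  have habs : |((s : ℝ))⁻¹| = 1 := by rcases hs with rfl | rfl <;> norm_num
  have h2 : J = (fun y => (s : ℝ) * y) ⁻¹' J₀ := by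
    ext y
    simp only [hJ, Set.mem_preimage, hJ₀, Set.mem_setOf_eq, ha', Int.cast_mul]
    rw [show ((s : ℝ) * a) * y = (a : ℝ) * ((s : ℝ) * y) by ring]
  unfold archFactor
  rw [h1, volume_pi_pi, Fin.prod_univ_one, h2, Real.volume_preimage_mul_left hs0, habs,
    ENNReal.ofReal_one, one_mul]

/-! ### The joint rough cell of one form as a count over the window -/

/-- **The crux's cell for one form.** For `N^{1/u} ≥ 2`, the joint rough `Ω`-cell
`#{n ∈ [-N, N] : (n) ∈ K, N^{1/u} < P⁻(ψ(n)⁺), Ω(ψ(n)⁺) = j₀}` equals, after the reflection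
`n = s m`, the number of integers `m ∈ [-N, N]` of the window `J` whose value `a' m + b` is
`N^{1/u}`-rough with `Ω = j₀` (roughness forces `ψ(n) ≥ 2`, i.e. `(n) ∈ {ψ > 0}`). -/
theorem lawOne_count {N u : ℕ} (Ψ : Fin 1 → AffLinForm 1) (K : Set (Fin 1 → ℝ)) (j : Fin 1 → ℕ)
    {s a b a' : ℤ} (hs : s = 1 ∨ s = -1) (ha : (Ψ 0).coeff 0 = a) (hb : (Ψ 0).const = b)
    (ha' : a' = s * a) {J : Set ℝ}
    (hJ : ∀ y, y ∈ J ↔ (fun _ : Fin 1 => (s : ℝ) * y) ∈ K ∧ 0 < (a' : ℝ) * y + b)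
    (hNu : (2 : ℝ) ≤ (N : ℝ) ^ ((1 : ℝ) / u)) :
    ((latticeBox 1 N).filter (fun n => realPoint n ∈ K ∧
        ∀ k, (N : ℝ) ^ ((1 : ℝ) / u) < (Nat.minFac ((Ψ k).eval n).toNat : ℝ) ∧
          ArithmeticFunction.cardFactors ((Ψ k).eval n).toNat = j k)).card =
      ((Finset.Icc (-(N : ℤ)) N).filter (fun m : ℤ => (m : ℝ) ∈ J ∧
        ((N : ℝ) ^ ((1 : ℝ) / u) < (Nat.minFac (a' * m + b).toNat : ℝ) ∧
          ArithmeticFunction.cardFactors (a' * m + b).toNat = j 0))).card := by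
  have hss : s * s = 1 := by rcases hs with rfl | rfl <;> norm_num
  have hssR : (s : ℝ) * s = 1 := by exact_mod_cast hss
  have heval : ∀ (k : Fin 1) (n : Fin 1 → ℤ), (Ψ k).eval n = a * n 0 + b := fun k n => by
    rw [lawOne_eval, ha, hb]
  have hIcc : ∀ x : ℤ, s * x ∈ Finset.Icc (-(N : ℤ)) N ↔ x ∈ Finset.Icc (-(N : ℤ)) N := fun x => by
    rcases hs with rfl | rfl
    · rw [one_mul]
    · simp only [Finset.mem_Icc]
      omega
  have hval : ∀ x : ℤ, a' * (s * x) + b = a * x + b := fun x => by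
    rw [ha', show s * a * (s * x) = (s * s) * (a * x) by ring, hss, one_mul]
  refine Finset.card_nbij' (fun n => s * n 0) (fun m => fun _ => s * m) ?_ ?_ ?_ ?_
  · intro n hn
    rw [Finset.mem_coe, Finset.mem_filter] at hn
    obtain ⟨hbox, hK, hP⟩ := hn
    have hP0 := hP 0
    rw [heval] at hP0
    have h2 : 2 ≤ (a * n 0 + b).toNat := lawOne_two_le_of_lt_minFac hNu hP0.1
    have hpos : 0 < a * n 0 + b := by omega
    rw [Finset.mem_coe, Finset.mem_filter, hval]
    refine ⟨(hIcc _).mpr (Fintype.mem_piFinset.mp hbox 0), ?_, hP0⟩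
    rw [hJ]
    refine ⟨?_, ?_⟩
    · have : (fun _ : Fin 1 => (s : ℝ) * ((s * n 0 : ℤ) : ℝ)) = realPoint n := by
        funext i
        rw [Fin.fin_one_eq_zero i, realPoint]
        push_cast
        rw [← mul_assoc, hssR, one_mul]
      rw [this]
      exact hK
    · have : (0 : ℝ) < ((a' * (s * n 0) + b : ℤ) : ℝ) := by
        rw [hval]
        exact_mod_cast hpos
      show (0 : ℝ) < (a' : ℝ) * ((s * n 0 : ℤ) : ℝ) + b
      push_cast at this ⊢
      exact this
  · intro m hm
    rw [Finset.mem_coe, Finset.mem_filter] at hm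
    obtain ⟨hmI, hmJ, hP⟩ := hm
    rw [Finset.mem_coe, Finset.mem_filter]
    refine ⟨Fintype.mem_piFinset.mpr fun _ => (hIcc m).mpr hmI, ?_, fun k => ?_⟩
    · have : realPoint (fun _ : Fin 1 => s * m) = fun _ => (s : ℝ) * m := by
        funext i
        simp [realPoint]
      rw [this]
      exact ((hJ m).mp hmJ).1
    · rw [heval, Fin.fin_one_eq_zero k]
      show (N : ℝ) ^ ((1 : ℝ) / u) < (Nat.minFac (a * (s * m) + b).toNat : ℝ) ∧
        ArithmeticFunction.cardFactors (a * (s * m) + b).toNat = j 0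
      rw [show a * (s * m) + b = a' * m + b by rw [ha']; ring]
      exact hP
  · intro n _
    funext i
    show s * (s * n 0) = n i
    rw [Fin.fin_one_eq_zero i, ← mul_assoc, hss, one_mul]
  · intro m _
    show s * (s * m) = m
    rw [← mul_assoc, hss, one_mul]

/-! ### The stub -/

/-- **Stub `stub_lawOneNorm` of the line `SketchIdeator1` (model transfer): `SegmentLawOne → CellModelLaw 1`**,
unfolded. For `Ψ = (a n + b)` and `K` convex in `[-N, N]` with `η N ≤ β_∞ 𝔖`: `𝔖 > 0` forces
`gcd(a, b) = 1`, `𝔖 ≤ B(L)` forces `β_∞ = vol(J) ≥ η N/B`; after the reflection `a' = |a|`, the map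
`n ↦ a' n + b` carries the integer points of the window `J` (consecutive integers) onto the class
`b mod a'` of a segment `(M₁, M₂] ⊆ (0, L N]` of length `≥ (η/2B) N`, so the segment law with
`η' = η/(2B)` is the cell law with `Λ = (M₂ - M₁)/(φ(a') log N)`; `N₀ = max (N₀', 2^u, ⌈2B/η⌉)`. -/
theorem stub_lawOneNorm :
(∀ (L u : ℕ), 2 ≤ u → ∀ η : ℝ, 0 < η → ∀ ε : ℝ, 0 < ε → ∃ N₀ : ℕ, ∀ N : ℕ, N₀ ≤ N →
      ∀ q r : ℕ, 1 ≤ q → q ≤ L → r.Coprime q → ∀ M₁ M₂ : ℕ, M₁ ≤ M₂ → (M₂ : ℝ) ≤ L * N →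
      η * N ≤ (M₂ : ℝ) - M₁ → ∀ j : ℕ, 1 ≤ j → j ≤ u →
        |((((Finset.Ioc M₁ M₂).filter (fun m => m ≡ r [MOD q] ∧
              (N : ℝ) ^ ((1 : ℝ) / u) < (Nat.minFac m : ℝ) ∧ ArithmeticFunction.cardFactors m = j)).card : ℕ) : ℝ) -
            ((M₂ : ℝ) - M₁) / ((Nat.totient q : ℝ) * Real.log N) * cellDensity (j - 1) u| ≤
          ε * (((M₂ : ℝ) - M₁) / ((Nat.totient q : ℝ) * Real.log N)) * (if j < u then cellDensity (j - 1) u else 1)) →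
    ∀ (L u : ℕ), 2 ≤ u → ∀ η : ℝ, 0 < η → ∀ ε : ℝ, 0 < ε → ∃ N₀ : ℕ, ∀ N : ℕ, N₀ ≤ N →
      ∀ Ψ : Fin 1 → AffLinForm 1, IsNondegenerateSystem Ψ → affLinSize Ψ N ≤ L →
      ∀ K : Set (Fin 1 → ℝ), Convex ℝ K → K ⊆ realBox 1 N →
      η * (N : ℝ) ≤ archFactor Ψ K * singularProduct Ψ →
      ∃ Λ : ℝ, 0 < Λ ∧ ∀ j ∈ Fintype.piFinset (fun _ : Fin 1 => Finset.Icc 1 u),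
        |((((latticeBox 1 N).filter (fun n => realPoint n ∈ K ∧
            ∀ k, (N : ℝ) ^ ((1 : ℝ) / u) < (Nat.minFac ((Ψ k).eval n).toNat : ℝ) ∧
              ArithmeticFunction.cardFactors ((Ψ k).eval n).toNat = j k)).card : ℕ) : ℝ) - Λ * ∏ k, cellDensity (j k - 1) u| ≤
          ε * Λ * ∏ k ∈ Finset.univ.filter (fun k => j k < u), cellDensity (j k - 1) u := by
  intro H L u hu η hη ε hε
  -- constants: the singular-product bound `B = B(L) ≥ 1`, `η' = η/(2B)`, and `N₀`
  obtain ⟨B, hB1, hB⟩ := lawOne_singularProduct_le L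
  have hB0 : 0 < B := by linarith
  set η' : ℝ := η / (2 * B) with hη'_def
  have hη'0 : 0 < η' := by positivity
  obtain ⟨N₀, hN₀⟩ := H L u hu η' hη'0 ε hε
  refine ⟨max N₀ (max (2 ^ u) ⌈2 * B / η⌉₊), fun N hN Ψ hΨ hΨL K hK hKN hmass => ?_⟩
  have hNN₀ : N₀ ≤ N := le_trans (le_max_left _ _) hN
  have hN2u : 2 ^ u ≤ N := le_trans ((le_max_left _ _).trans (le_max_right _ _)) hN
  have hNη : ⌈2 * B / η⌉₊ ≤ N := le_trans ((le_max_right _ _).trans (le_max_right _ _)) hN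
  have hN2 : 2 ≤ N := by
    have : 2 ^ 1 ≤ 2 ^ u := Nat.pow_le_pow_right (by norm_num) (by omega)
    omega
  have hN0 : (0 : ℝ) < N := by exact_mod_cast (show 0 < N by omega)
  have hNu : (2 : ℝ) ≤ (N : ℝ) ^ ((1 : ℝ) / u) := lawOne_two_le_rpow hu hN2u
  -- the form `a n + b`, the sign `s`, `a' = s a = |a| ≥ 1`
  set a : ℤ := (Ψ 0).coeff 0 with ha_def
  set b : ℤ := (Ψ 0).const with hb_def
  have ha0 : a ≠ 0 := by
    intro h
    apply hΨ.1 0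
    funext i
    rw [Fin.fin_one_eq_zero i, Pi.zero_apply, ← ha_def]
    exact h
  set s : ℤ := if 0 < a then 1 else -1 with hs_def
  have hs : s = 1 ∨ s = -1 := by
    rw [hs_def]
    split_ifs <;> simp
  set a' : ℤ := s * a with ha'_def
  have hsa : 0 < a' := by
    rw [ha'_def, hs_def]
    split_ifs with h
    · linarith
    · have : a < 0 := lt_of_le_of_ne (not_lt.mp h) ha0
      linarith
  have haa : |a| = a' := by
    rcases hs with h | h
    · have e : a' = a := by rw [ha'_def, h, one_mul]
      rw [e] at hsa ⊢
      exact abs_of_pos hsa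
    · have e : a' = -a := by rw [ha'_def, h, neg_one_mul]
      rw [e] at hsa ⊢
      exact abs_of_neg (by linarith)
  have hcoefL : ∀ i k, ((Ψ i).coeff k).natAbs ≤ L := fun i k =>
    natAbs_coeff_le_of_affLinSize_le hΨL i k
  have ha'L : a' ≤ L := by
    have h1 : a.natAbs ≤ L := by rw [ha_def]; exact hcoefL 0 0
    have h2 : ((a.natAbs : ℕ) : ℤ) = |a| := Int.natCast_natAbs a
    omega
  have habN : (a' : ℝ) * N + |(b : ℝ)| ≤ L * N := by
    have h := lawOne_size (show 0 < N by omega) hΨL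
    rw [← ha_def, ← hb_def, ← Int.cast_abs, haa] at h
    exact h
  -- the window
  set J : Set ℝ := {y | (fun _ : Fin 1 => (s : ℝ) * y) ∈ K ∧ 0 < (a' : ℝ) * y + b} with hJ_def
  have hJ : ∀ y, y ∈ J ↔ (fun _ : Fin 1 => (s : ℝ) * y) ∈ K ∧ 0 < (a' : ℝ) * y + b :=
    fun y => Iff.rfl
  have hJord : J.OrdConnected := lawOne_window_ordConnected Ψ hK ha_def.symm hb_def.symm ha'_def hJ
  have hJN : J ⊆ Set.Icc (-(N : ℝ)) N := lawOne_window_subset hKN hs hJ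
  have hJpos : ∀ y ∈ J, 0 < (a' : ℝ) * y + b := fun y hy => hy.2
  have harch : archFactor Ψ K = (volume J).toReal :=
    lawOne_archFactor Ψ K hs ha_def.symm hb_def.symm ha'_def hJ
  -- the singular product: positive (so `gcd(a, b) = 1`) and at most `B`
  have hSB : singularProduct Ψ ≤ B := hB Ψ hΨ hcoefL
  have hvol0 : 0 ≤ (volume J).toReal := ENNReal.toReal_nonneg
  have hS0 : 0 < singularProduct Ψ := by
    by_contra h
    have h1 : archFactor Ψ K * singularProduct Ψ ≤ 0 :=
      mul_nonpos_of_nonneg_of_nonpos (harch ▸ hvol0) (not_lt.mp h)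
    nlinarith [mul_pos hη hN0]
  have hgcd : Int.gcd a' b = 1 := by
    have hg := lawOne_gcd_eq_one_of_singularProduct_pos Ψ hS0
    rw [← ha_def, ← hb_def] at hg
    rcases hs with h | h
    · rw [ha'_def, h, one_mul]
      exact hg
    · rw [ha'_def, h, neg_one_mul, Int.neg_gcd]
      exact hg
  -- `vol(J) ≥ η N / B ≥ η' N + 1`
  have hvol : η' * N + 1 ≤ (volume J).toReal := by
    have h1 : η * N ≤ (volume J).toReal * B := by
      rw [harch] at hmass
      exact hmass.trans (mul_le_mul_of_nonneg_left hSB hvol0)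
    have h2 : 2 * B / η ≤ N := (Nat.le_ceil _).trans (by exact_mod_cast hNη)
    rw [div_le_iff₀ hη] at h2
    have h3 : η' * N * (2 * B) = η * N := by
      rw [hη'_def]
      field_simp
    have h4 : 1 ≤ η' * N := by
      by_contra h5
      have : η' * N * (2 * B) < 1 * (2 * B) := mul_lt_mul_of_pos_right (not_le.mp h5) (by positivity)
      linarith
    have h6 : 2 * (η' * N) ≤ (volume J).toReal := le_of_mul_le_mul_right (by linarith) hB0
    linarith
  -- the one-dimensional law on the window
  obtain ⟨Λ, hΛ, hmain⟩ :=
    lawOne_oneDim hN2 hη'0 (hN₀ N hNN₀) hsa ha'L hgcd habN hJord hJN hJpos hvol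
  refine ⟨Λ, hΛ, fun j hj => ?_⟩
  have hj0 : j 0 ∈ Finset.Icc 1 u := Fintype.mem_piFinset.mp hj 0
  rw [lawOne_count Ψ K j hs ha_def.symm hb_def.symm ha'_def hJ hNu, Fin.prod_univ_one,
    Finset.prod_filter, Fin.prod_univ_one]
  exact hmain (j 0) hj0

end Summit.Parity.GeneralizedHardyLittlewood.Cruxes.FibreHyperbolicity.ModelTransfer

end
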